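import Mathlib.LinearAlgebra.Prod
import Mathlib.Data.Set.Finite.Basic
import Mathlib.Tactic.Abel
import HarnessLib

/-!
# FIX-REDUCTION: finitely many `⟨P, σ₁⟩`-fixed vectors from a TRIANGULAR model — the `y`-coordinate is killed by
# `δ(σ₁) − 1`, the `x`-coordinate is then pinned by an element `σ₀ ∈ P` with `χ(σ₀) − 1` a unit
# (helper for the v6 stub (FIX) of crux 25505, `--supports stmt-BirchSwinnertonDyer-25505`)

Cell `bsd-stepL`, seat `bsd-stepL-imc-p1` (prover g23, 2026-08-28). Theorems only (no definition, no named fact, no `sorry`, no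
instance, no notation). Step (2) of the proof plan of (FIX) (memo `LOCALDEFECT-25505-imc-p1-g23.md` §1bis): once the ordinary frame
of [Wiles88 Thm 2.2 ∕ Hida2000 Thm 3.26 (2)] (tree named fact `Hida2000_thm326_ordinary_unitRoot`) puts `A_g|_{Γ_{K_𝔭̄}}` in
triangular form `A_g ≅ B × B`, `σ ↦ (χ(σ) e(σ); 0 δ(σ))` (`B = F/𝒪`), the finiteness of the vectors fixed by `P = G_{K̃_{∞,𝔭̄}}` and by
`σ₁` follows from two SCALAR facts: some `σ₀ ∈ P` has `χ(σ₀) − 1 ∈ 𝒪ˣ` (a `(p−1)`-torsion inertia element: `ζ^{k−1} − 1`), and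
`B[δ(σ₁) − 1]` is finite (`δ(σ₁) ≠ 1`: local rank two + Deligne). This file proves exactly that implication, for any module `A`
with a linear isomorphism to `B × B` intertwining the action with a triangular one; no group structure is used.

* `finite_fixed_of_triangular` — the coordinate statement on `B × B`;
* `finite_fixed_of_triangular_model` — transported to `A ≃ₗ[𝒪] B × B`, in the binder shape of (FIX)
  (`{a | (∀ σ, P₁ σ → P₂ σ → ρ σ a = a) ∧ ρ σ₁ a = a}.Finite`).

HONEST FRAMING: algebra; nothing about any newform or curve; conditional on nothing; BSD proved for no pair; closes: none (T7).

## References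
* [JetchevSkinnerWan2017] §3.3 Case 3(b) (arXiv:1512.06894 p. 13: the analysis of `V^{P_v}` on the ordinary filtration).
* [Greenberg1989] §1 p. 98 ((1)–(4): the filtration `F⁺` and `A/F⁺A`).
-/

set_option autoImplicit false

-- D-0017: single-problem summit, the namespace repeats the problem name by design.
set_option linter.dupNamespace false

namespace Summit.BirchSwinnertonDyer.BirchSwinnertonDyer.Theorems.ErratumThm23TwoVariable.FixReduction

variable {𝒪 : Type*} [CommRing 𝒪] {B : Type*} [AddCommGroup B] [Module 𝒪 B] {ι : Type*}

/-- **Finitely many fixed vectors in a triangular model.** On `B × B` let index `i` act by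
`(x, y) ↦ (χᵢx + eᵢy, δᵢy)`. If some `i₀` with `P i₀` has `χ_{i₀} − 1` a unit and `B[δ_{i₁} − 1]` is finite, then only finitely
many `(x, y)` are fixed by all `i` with `P i` and by `i₁`: `y ∈ B[δ_{i₁} − 1]`, and `(χ_{i₀} − 1)x = −e_{i₀}y` pins `x`.
[cite: JetchevSkinnerWan2017, §3.3, Case 3(b) (arXiv:1512.06894 p. 13)] -/
theorem finite_fixed_of_triangular (χ e δ : ι → 𝒪) (P : ι → Prop) (i₁ : ι)
    (h₀ : ∃ i₀, P i₀ ∧ IsUnit (χ i₀ - 1)) (h₁ : {y : B | (δ i₁ - 1) • y = 0}.Finite) :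
    {a : B × B | (∀ i, P i → (χ i • a.1 + e i • a.2, δ i • a.2) = a) ∧
      (χ i₁ • a.1 + e i₁ • a.2, δ i₁ • a.2) = a}.Finite := by
  obtain ⟨i₀, hP₀, hu⟩ := h₀
  refine Set.Finite.of_finite_image (f := Prod.snd) (h₁.subset ?_) ?_
  · rintro _ ⟨a, ⟨-, ha₁⟩, rfl⟩
    have hy : δ i₁ • a.2 = a.2 := congrArg Prod.snd ha₁
    change (δ i₁ - 1) • a.2 = 0
    rw [sub_smul, one_smul, hy, sub_self]
  · rintro a ⟨ha, -⟩ a' ⟨ha', -⟩ (hy : a.2 = a'.2)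
    have hx : χ i₀ • a.1 + e i₀ • a.2 = a.1 := congrArg Prod.fst (ha i₀ hP₀)
    have hx' : χ i₀ • a'.1 + e i₀ • a'.2 = a'.1 := congrArg Prod.fst (ha' i₀ hP₀)
    have hdiff : (χ i₀ - 1) • (a.1 - a'.1) = 0 := by
      rw [smul_sub, sub_smul, sub_smul, one_smul, one_smul]
      have e1 : χ i₀ • a.1 = a.1 - e i₀ • a.2 := eq_sub_of_add_eq hx
      have e2 : χ i₀ • a'.1 = a'.1 - e i₀ • a'.2 := eq_sub_of_add_eq hx'
      rw [e1, e2, hy]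
      abel
    obtain ⟨u, hu'⟩ := hu
    have hx1 : a.1 = a'.1 := by
      have h2 : ((u⁻¹ : 𝒪ˣ) : 𝒪) • ((χ i₀ - 1) • (a.1 - a'.1)) = 0 := by rw [hdiff, smul_zero]
      rw [← hu', smul_smul, Units.inv_mul, one_smul] at h2
      exact sub_eq_zero.mp h2
    exact Prod.ext hx1 hy

/-- **FIX-REDUCTION in the binder shape of (FIX).** Let `ρ` assign to each `σ` an `𝒪`-linear endomorphism of `A`, and let
`Φ : A ≃ₗ[𝒪] B × B` put every `ρ σ` in triangular form `(χ(σ) e(σ); 0 δ(σ))`. If some `σ₀` with `P₁ σ₀`, `P₂ σ₀` has `χ(σ₀) − 1`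
a unit and `B[δ(σ₁) − 1]` is finite, then `{a | (∀ σ, P₁ σ → P₂ σ → ρ σ a = a) ∧ ρ σ₁ a = a}` is finite.
(For `A = A_g|_{Γ_{K_𝔭̄}}`, `B = F/𝒪`, the frame of [Wiles88 Thm 2.2], `P = (κ' = 0 ∧ κ = 0)`: the v6 stub of line `erratum_chain`.)
[cite: JetchevSkinnerWan2017, §3.3, Case 3(b) (arXiv:1512.06894 p. 13)] [cite: Greenberg1989, §1 p. 98] -/
theorem finite_fixed_of_triangular_model {A : Type*} [AddCommGroup A] [Module 𝒪 A]
    {F : Type*} [FunLike F ι (A →ₗ[𝒪] A)] (ρ : F) (Φ : A ≃ₗ[𝒪] B × B)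
    (χ e δ : ι → 𝒪) (hΦ : ∀ σ a, Φ (ρ σ a) = (χ σ • (Φ a).1 + e σ • (Φ a).2, δ σ • (Φ a).2))
    (P₁ P₂ : ι → Prop) (σ₁ : ι)
    (h₀ : ∃ σ₀, P₁ σ₀ ∧ P₂ σ₀ ∧ IsUnit (χ σ₀ - 1)) (h₁ : {y : B | (δ σ₁ - 1) • y = 0}.Finite) :
    {a : A | (∀ σ, P₁ σ → P₂ σ → ρ σ a = a) ∧ ρ σ₁ a = a}.Finite := by
  obtain ⟨σ₀, h₀₁, h₀₂, hu⟩ := h₀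
  have hfin := finite_fixed_of_triangular (B := B) χ e δ (fun σ ↦ P₁ σ ∧ P₂ σ) σ₁ ⟨σ₀, ⟨h₀₁, h₀₂⟩, hu⟩ h₁
  refine Set.Finite.of_finite_image (f := Φ) (hfin.subset ?_) Φ.injective.injOn
  rintro _ ⟨a, ⟨ha, ha₁⟩, rfl⟩
  refine ⟨fun σ hσ ↦ ?_, ?_⟩
  · rw [← hΦ σ a, ha σ hσ.1 hσ.2]
  · rw [← hΦ σ₁ a, ha₁]

end Summit.BirchSwinnertonDyer.BirchSwinnertonDyer.Theorems.ErratumThm23TwoVariable.FixReduction
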